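import Mathlib
import HarnessLib
import Literature.MathematicalPhysics.AQFT.OSAxiomsSchwinger
import Literature.MathematicalPhysics.QuantumLattice.SchwartzPartition
import Literature.MathematicalPhysics.QuantumLattice.SchwartzNuclearExpansionBounds
import Summits.QuantumFields.YangMills.Theorems.MirrorModularBoostsHypercubicLimitSeparatedScaleBoundExplicitPrep

/-!
# Line `Sketch` (coupling response) of crux `HypercubicLimit`, step Z1-explicit E4: the single-scale
# lattice partition of unity for separated test functions, with explicit degree dependence

Sub-goal `separatedScaleBound_explicit` (stmt-QuantumFields-16154, registered skeleton
`Cruxes/HypercubicLimit/Lines/Sketch.lean`).  A continuous linear functional `T` on `𝓢((ℝ⁴)ⁿ, ℂ)` whose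
localised versions obey the bound HLoc (for slot cutoffs `θᵢ` with pairwise disjoint supports,
`‖T((∏ᵢ θᵢ(xᵢ)) F)‖ ≤ M Kⁿ ∏ᵢ |θᵢ|_t |F|_{nt}`) is bounded, on test functions whose support stays at
pairwise slot distances `≥ 64 ε`, by `M Kⁿ A^{n+1} (n+1)^{2n(t+3)} ε^{-16n(t+3)} |F|_{n(4t+12)}` with `A = A(t)`
INDEPENDENT of the degree `n` (the non-explicit version is `separatedScaleBound`).

Proof.  (1) Scale `ε = 1` (`unitScaleBound_explicit`): flatten `(ℝ⁴)ⁿ ≃ ℝ^{4n}` and cut `F` with the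
lattice partition of unity `η_β`, `β ∈ ℤ^{4n}` (`∑_{β ∈ [-R,R]^{4n}} η_β F → F` in `𝓢`,
`NuclearExpansion.tendsto_sum_eta`).  A multi-index with two slots within `2` in every coordinate carries no
mass (`eta_eq_zero_of_near_slots`); otherwise `η_β F = (∏ᵢ θ'_{βᵢ}(xᵢ)) · F♯` with the DECAYING slot cutoffs
`θ'_b(z) = (∏_c ρ(z_c - b_c)) (1 + ‖z‖²)^{-(t+4)}` of pairwise disjoint supports,
`|θ'_b|_t ≤ A₁(t) ∏_c (1 + |b_c|)^{-2}` (`exists_decayingCutoffs`), and the FIXED weighted test function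
`F♯ = (∏ᵢ (1 + ‖xᵢ‖²)^{t+4}) F`, `|F♯|_{nt} ≤ (n(t+4)+1)^{nt} 2^{n(4t+12)} |F|_{n(3t+8)}` (`exists_weightMul`).
HLoc and `∑_{β ∈ cube} ∏_k (1 + |β_k|)^{-2} ≤ (∑_{j ∈ ℤ} (1 + |j|)^{-2})^{4n}` (`Finset.prod_univ_sum`) give
`‖T F‖ ≤ M Kⁿ A₃(t)ⁿ (n+1)^{nt} |F|_{n(3t+8)}`.  (2) General `ε` by rescaling: `T F = T_ε F_ε`,
`F_ε = F(ε ·)` is `64`-separated and `T_ε = T ∘ (· ∘ ε⁻¹)` obeys HLoc with `M ε^{-4nt}`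
(`NuclearExpansion.schwartzNorm_compCLMOfContinuousLinearEquiv_le`); `|F_ε|_{t'} ≤ ε^{-2t'} |F|_{t'}`; the
total power `10nt + 16n ≤ 16n(t+3)` and the order `n(3t+8) ≤ n(4t+12)` are then enlarged to the registered
shape.
-/

noncomputable section

open scoped SchwartzMap
open MeasureTheory Filter Topology
open Literature.MathematicalPhysics.AQFT Literature.MathematicalPhysics.QuantumLattice

namespace Summit.QuantumFields.YangMills.Cruxes.HypercubicLimit.CouplingResponse

/-- Flattening by slot coordinates `(ℝ⁴)ⁿ ≃ ℝ^{4n}`, `Λ(x)_{(i,c)} = (xᵢ)_c`. [folklore] -/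
theorem exists_slotFlatten (n : ℕ) :
    ∃ Λ : (Fin n → EuclideanSpace ℝ (Fin 4)) ≃L[ℝ] EuclideanSpace ℝ (Fin (n * 4)),
      ∀ x i c, Λ x (finProdFinEquiv (i, c)) = x i c := by
  refine ⟨LinearEquiv.toContinuousLinearEquiv
    { toFun := fun x => WithLp.toLp 2 fun k => x (finProdFinEquiv.symm k).1 (finProdFinEquiv.symm k).2
      map_add' := fun x y => rfl
      map_smul' := fun r x => rfl
      invFun := fun z i => WithLp.toLp 2 fun c => z (finProdFinEquiv (i, c))
      left_inv := fun x => by funext i; ext c; simp only [Equiv.symm_apply_apply]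
      right_inv := fun z => by ext k; simp only [Prod.mk.eta, Equiv.apply_symm_apply] }, fun x i c => ?_⟩
  simp only [LinearEquiv.coe_toContinuousLinearEquiv', LinearEquiv.coe_mk, LinearMap.coe_mk,
    AddHom.coe_mk, PiLp.toLp_apply, Equiv.symm_apply_apply]

/-- **Near-diagonal multi-indices carry no mass.** If two slots of `β ∈ ℤ^{4n}` are within `2` in every
coordinate, the piece `η_β F` of a `64`-separated `F` vanishes: on `supp η_β` the two slots are within
`2 · 4 = 8`. [folklore] -/
theorem eta_eq_zero_of_near_slots {n : ℕ}
    (Λ : (Fin n → EuclideanSpace ℝ (Fin 4)) ≃L[ℝ] EuclideanSpace ℝ (Fin (n * 4)))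
    (hΛ : ∀ x i c, Λ x (finProdFinEquiv (i, c)) = x i c) {F : 𝓢((Fin n → EuclideanSpace ℝ (Fin 4)), ℂ)}
    (hF : ∀ x ∈ tsupport (F : (Fin n → EuclideanSpace ℝ (Fin 4)) → ℂ), ∀ i j, i ≠ j →
      (64 : ℝ) ≤ ‖x i - x j‖)
    (β : Fin (n * 4) → ℤ) {i j : Fin n} (hij : i ≠ j)
    (hnear : ∀ c, |(β (finProdFinEquiv (i, c)) : ℝ) - β (finProdFinEquiv (j, c))| ≤ 2) :
    NuclearExpansion.eta Λ β F = 0 := by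
  refine SchwartzMap.ext fun y => ?_
  show NuclearExpansion.eta Λ β F y = 0
  by_contra hy
  have hyt : y ∈ tsupport (NuclearExpansion.eta Λ β F : (Fin n → EuclideanSpace ℝ (Fin 4)) → ℂ) :=
    subset_tsupport _ hy
  have hcoord : ∀ k, (Λ y) k - (β k : ℝ) ∈ Set.Icc (-1 : ℝ) 1 :=
    NuclearExpansion.tsupport_eta_subset Λ β F hyt
  have hyF : y ∈ tsupport (F : (Fin n → EuclideanSpace ℝ (Fin 4)) → ℂ) := by
    refine tsupport_mul_subset_right (f := fun y => ((latticeBump Λ β y : ℝ) : ℂ)) ?_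
    rwa [show (fun y => ((latticeBump Λ β y : ℝ) : ℂ) * F y) = ⇑(NuclearExpansion.eta Λ β F) from
      funext fun y => (NuclearExpansion.eta_apply Λ β F y).symm]
  have h64 := hF y hyF i j hij
  have hc : ∀ c, |(y i - y j) c| ≤ 4 := by
    intro c
    have hi := hcoord (finProdFinEquiv (i, c))
    have hj := hcoord (finProdFinEquiv (j, c))
    rw [hΛ, Set.mem_Icc] at hi hj
    have h2 := abs_le.1 (hnear c)
    rw [PiLp.sub_apply, abs_le]
    constructor <;> linarith [hi.1, hi.2, hj.1, hj.2, h2.1, h2.2]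
  have hnorm := EuclideanSpace.norm_le_sqrt_card_mul (y i - y j) (by norm_num : (0 : ℝ) ≤ 4) hc
  rw [Fintype.card_fin, Nat.cast_ofNat, show (4 : ℝ) = 2 ^ 2 by norm_num, Real.sqrt_sq zero_le_two] at hnorm
  linarith

/-- **The explicit bound at scale one.**  If `T` obeys HLoc with constant `M₀` (for slot cutoffs with
pairwise disjoint supports, `‖T((∏ᵢ θᵢ(xᵢ)) F)‖ ≤ M₀ ∏ᵢ |θᵢ|_t |F|_{nt}`), then for every `F` whose support
is `64`-separated in the slots, `‖T F‖ ≤ M₀ A₃ⁿ (n+1)^{nt} |F|_{n(3t+8)}` with `A₃ = A₃(t) ≥ 1`: lattice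
partition of unity in slot coordinates, near cells empty (`eta_eq_zero_of_near_slots`), far cells factorised
through the decaying cutoffs `θ'_{βᵢ}` (`exists_decayingCutoffs`) and the weighted test function `F♯`
(`exists_weightMul`), and the tensorised lattice sum `∑_β ∏_k (1 + |β_k|)^{-2} ≤ S₁^{4n}`. [folklore] -/
theorem unitScaleBound_explicit (t : ℕ) : ∃ A₃ : ℝ, 1 ≤ A₃ ∧ ∀ (n : ℕ)
    (T : 𝓢((Fin n → EuclideanSpace ℝ (Fin 4)), ℂ) →L[ℂ] ℂ) (M₀ : ℝ), 0 ≤ M₀ →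
    (∀ (θ : Fin n → 𝓢(EuclideanSpace ℝ (Fin 4), ℂ)),
      (∀ i j, i ≠ j → Disjoint (tsupport (θ i : EuclideanSpace ℝ (Fin 4) → ℂ))
        (tsupport (θ j : EuclideanSpace ℝ (Fin 4) → ℂ))) →
      ∀ (G F : 𝓢((Fin n → EuclideanSpace ℝ (Fin 4)), ℂ)), (∀ x, G x = (∏ i, θ i (x i)) * F x) →
        ‖T G‖ ≤ M₀ * (∏ i, schwartzNorm t (θ i)) * schwartzNorm (n * t) F) →
    ∀ F : 𝓢((Fin n → EuclideanSpace ℝ (Fin 4)), ℂ),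
      (∀ x ∈ tsupport (F : (Fin n → EuclideanSpace ℝ (Fin 4)) → ℂ), ∀ i j, i ≠ j →
        (64 : ℝ) ≤ ‖x i - x j‖) →
      ‖T F‖ ≤ M₀ * A₃ ^ n * ((n : ℝ) + 1) ^ (n * t) * schwartzNorm (n * (3 * t + 8)) F := by
  obtain ⟨A₁, hA₁, hθ⟩ := exists_decayingCutoffs t
  set g₁ : ℤ → ℝ := fun k => ((1 + |(k : ℝ)|) ^ 2)⁻¹ with hg₁
  have hg₁0 : ∀ k, 0 ≤ g₁ k := fun k => by positivity
  set S₁ : ℝ := ∑' k : ℤ, g₁ k with hS₁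
  have hS₁0 : 0 ≤ S₁ := tsum_nonneg hg₁0
  set A₂ : ℝ := A₁ * S₁ ^ 4 * ((t : ℝ) + 4) ^ t * 2 ^ (4 * t + 12) with hA₂
  have hA₂0 : 0 ≤ A₂ := by positivity
  refine ⟨max 1 A₂, le_max_left _ _, fun n T M₀ hM₀ hloc F hsep => ?_⟩
  obtain ⟨Λ, hΛ⟩ := exists_slotFlatten n
  obtain ⟨G, hG, hGn⟩ := exists_weightMul (t + 4) F
  set X : ℝ := schwartzNorm (n * t) G with hX
  have hX0 : 0 ≤ X := schwartzNorm_nonneg _ _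
  -- the bound on one piece `T (η_β F)`
  have hpiece : ∀ β : Fin (n * 4) → ℤ, ‖T (NuclearExpansion.eta Λ β F)‖ ≤
      M₀ * A₁ ^ n * (∏ k, g₁ (β k)) * X := by
    intro β
    have hrhs : 0 ≤ M₀ * A₁ ^ n * (∏ k, g₁ (β k)) * X :=
      mul_nonneg (mul_nonneg (by positivity) (Finset.prod_nonneg fun k _ => hg₁0 _)) hX0
    by_cases hnear : ∃ i j : Fin n, i ≠ j ∧
        ∀ c, |(β (finProdFinEquiv (i, c)) : ℝ) - β (finProdFinEquiv (j, c))| ≤ 2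
    · obtain ⟨i, j, hij, hc⟩ := hnear
      rw [eta_eq_zero_of_near_slots Λ hΛ hsep β hij hc, map_zero, norm_zero]
      exact hrhs
    push Not at hnear
    -- far multi-indices: decaying slot cutoffs with pairwise disjoint supports
    obtain ⟨b, hb⟩ : ∃ b : Fin n → Fin 4 → ℤ, ∀ i c, b i c = β (finProdFinEquiv (i, c)) :=
      ⟨_, fun _ _ => rfl⟩
    choose θ hθv hθs hθn using fun i => hθ (b i)
    have hdisj : ∀ i j, i ≠ j → Disjoint (tsupport (θ i : EuclideanSpace ℝ (Fin 4) → ℂ))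
        (tsupport (θ j : EuclideanSpace ℝ (Fin 4) → ℂ)) := by
      intro i j hij
      obtain ⟨c, hc⟩ := hnear i j hij
      rw [← hb, ← hb] at hc
      refine Set.disjoint_left.2 fun z hzi hzj => ?_
      have h1 := abs_le.1 (hθs i hzi c)
      have h2 := abs_le.1 (hθs j hzj c)
      exact absurd (abs_le.2 ⟨by linarith [h1.2, h2.1], by linarith [h1.1, h2.2]⟩) (not_le.2 hc)
    -- the factorisation `η_β F = (∏ᵢ θ'_{βᵢ}(xᵢ)) · F♯`
    have hfac : ∀ x, NuclearExpansion.eta Λ β F x = (∏ i, θ i (x i)) * G x := by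
      intro x
      have hw : ∀ i, (∏ c, pouBump (x i c - b i c)) * ((1 + ‖x i‖ ^ 2) ^ (t + 4))⁻¹ *
          (1 + ‖x i‖ ^ 2) ^ (t + 4) = ∏ c, pouBump (x i c - b i c) := fun i => by
        rw [mul_assoc, inv_mul_cancel₀ (by positivity), mul_one]
      rw [NuclearExpansion.eta_apply, hG x, ← mul_assoc, Finset.prod_congr rfl fun i _ => hθv i (x i),
        ← Complex.ofReal_prod, ← Complex.ofReal_mul, ← Finset.prod_mul_distrib,
        Finset.prod_congr rfl fun i _ => hw i]
      congr 2
      rw [latticeBump, ← Fintype.prod_equiv finProdFinEquiv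
        (fun p => pouBump ((Λ x) (finProdFinEquiv p) - (β (finProdFinEquiv p) : ℝ)))
        (fun k => pouBump ((Λ x) k - (β k : ℝ))) (fun _ => rfl), Fintype.prod_prod_type]
      simp only [hΛ, hb]
    have hθprod : ∏ i, schwartzNorm t (θ i) ≤ A₁ ^ n * ∏ k, g₁ (β k) := by
      calc ∏ i, schwartzNorm t (θ i) ≤ ∏ i, (A₁ * ∏ c, g₁ (b i c)) :=
            Finset.prod_le_prod (fun i _ => schwartzNorm_nonneg _ _) fun i _ => hθn i
        _ = A₁ ^ n * ∏ i, ∏ c, g₁ (b i c) := by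
            rw [Finset.prod_mul_distrib, Finset.prod_const, Finset.card_univ, Fintype.card_fin]
        _ = A₁ ^ n * ∏ k, g₁ (β k) := by
            rw [← Fintype.prod_equiv finProdFinEquiv (fun p : Fin n × Fin 4 => g₁ (b p.1 p.2))
              (fun k => g₁ (β k)) (fun p => by rw [hb]), Fintype.prod_prod_type]
    calc ‖T (NuclearExpansion.eta Λ β F)‖ ≤ M₀ * (∏ i, schwartzNorm t (θ i)) * X := hloc θ hdisj _ _ hfac
      _ ≤ M₀ * (A₁ ^ n * ∏ k, g₁ (β k)) * X :=
          mul_le_mul_of_nonneg_right (mul_le_mul_of_nonneg_left hθprod hM₀) hX0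
      _ = M₀ * A₁ ^ n * (∏ k, g₁ (β k)) * X := by ring
  -- sum over a cube: the lattice sum tensorises
  have hsumR : ∀ R : ℕ, ‖T (∑ β ∈ latticeCube (n * 4) R, NuclearExpansion.eta Λ β F)‖ ≤
      M₀ * A₁ ^ n * S₁ ^ (n * 4) * X := by
    intro R
    rw [map_sum]
    refine (norm_sum_le _ _).trans ((Finset.sum_le_sum fun β _ => hpiece β).trans ?_)
    have hsum : ∑ β ∈ latticeCube (n * 4) R, ∏ k, g₁ (β k) ≤ S₁ ^ (n * 4) := by
      rw [latticeCube, ← Finset.prod_univ_sum (fun _ => Finset.Icc (-(R : ℤ)) R) (fun _ k => g₁ k)]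
      calc ∏ _k : Fin (n * 4), ∑ j ∈ Finset.Icc (-(R : ℤ)) R, g₁ j ≤ ∏ _k : Fin (n * 4), S₁ :=
            Finset.prod_le_prod (fun _ _ => Finset.sum_nonneg fun j _ => hg₁0 j) fun _ _ =>
              summable_inv_one_add_abs_sq.sum_le_tsum _ fun j _ => hg₁0 j
        _ = S₁ ^ (n * 4) := by rw [Finset.prod_const, Finset.card_univ, Fintype.card_fin]
    calc ∑ β ∈ latticeCube (n * 4) R, M₀ * A₁ ^ n * (∏ k, g₁ (β k)) * X
        = M₀ * A₁ ^ n * X * ∑ β ∈ latticeCube (n * 4) R, ∏ k, g₁ (β k) := by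
          rw [Finset.mul_sum]
          exact Finset.sum_congr rfl fun β _ => by ring
      _ ≤ M₀ * A₁ ^ n * X * S₁ ^ (n * 4) := mul_le_mul_of_nonneg_left hsum (by positivity)
      _ = M₀ * A₁ ^ n * S₁ ^ (n * 4) * X := by ring
  have hlim : Tendsto (fun R : ℕ => ‖T (∑ β ∈ latticeCube (n * 4) R, NuclearExpansion.eta Λ β F)‖)
      atTop (𝓝 ‖T F‖) :=
    (continuous_norm.tendsto _).comp ((T.continuous.tendsto _).comp (NuclearExpansion.tendsto_sum_eta Λ F))
  -- the explicit constants
  have hT' : n * t + 2 * (n * (t + 4)) = n * (3 * t + 8) := by ring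
  have hbase : ((n * (t + 4) : ℕ) : ℝ) + 1 ≤ ((n : ℝ) + 1) * ((t : ℝ) + 4) := by
    push_cast
    nlinarith [(Nat.cast_nonneg t : (0 : ℝ) ≤ t)]
  have hF0 : 0 ≤ schwartzNorm (n * (3 * t + 8)) F := schwartzNorm_nonneg _ _
  have hA₂n : A₂ ^ n = A₁ ^ n * S₁ ^ (n * 4) * (((t : ℝ) + 4) ^ (n * t) * 2 ^ (n * t + 3 * (n * (t + 4)))) := by
    rw [hA₂, mul_pow, mul_pow, mul_pow, ← pow_mul, ← pow_mul, ← pow_mul, show 4 * n = n * 4 by ring,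
      show t * n = n * t by ring, show (4 * t + 12) * n = n * t + 3 * (n * (t + 4)) by ring]
    ring
  calc ‖T F‖ ≤ M₀ * A₁ ^ n * S₁ ^ (n * 4) * X := le_of_tendsto' hlim hsumR
    _ ≤ M₀ * A₁ ^ n * S₁ ^ (n * 4) * ((((n : ℝ) + 1) * ((t : ℝ) + 4)) ^ (n * t) *
          2 ^ (n * t + 3 * (n * (t + 4))) * schwartzNorm (n * (3 * t + 8)) F) := by
        rw [← hT']
        refine mul_le_mul_of_nonneg_left ((hGn (n * t)).trans ?_) (by positivity)
        exact mul_le_mul_of_nonneg_right (mul_le_mul_of_nonneg_right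
          (pow_le_pow_left₀ (by positivity) hbase _) (by positivity)) (schwartzNorm_nonneg _ _)
    _ = M₀ * (A₂ ^ n * ((n : ℝ) + 1) ^ (n * t)) * schwartzNorm (n * (3 * t + 8)) F := by
        rw [mul_pow, hA₂n]
        ring
    _ ≤ M₀ * ((max 1 A₂) ^ n * ((n : ℝ) + 1) ^ (n * t)) * schwartzNorm (n * (3 * t + 8)) F :=
        mul_le_mul_of_nonneg_right (mul_le_mul_of_nonneg_left (mul_le_mul_of_nonneg_right
          (pow_le_pow_left₀ hA₂0 (le_max_right _ _) n) (by positivity)) hM₀) hF0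
    _ = M₀ * (max 1 A₂) ^ n * ((n : ℝ) + 1) ^ (n * t) * schwartzNorm (n * (3 * t + 8)) F := by ring

/-- **Dilations.** `y ↦ ε y` (`0 < ε ≤ 1`) as a continuous linear automorphism `g`; the constants
`max(1, ‖g⁻¹‖, ‖g‖)` of `schwartzNorm_compCLMOfContinuousLinearEquiv_le` for `g` and `g⁻¹` are `≤ ε⁻¹`.
[folklore] -/
theorem exists_dilationEquiv (Y : Type*) [NormedAddCommGroup Y] [NormedSpace ℝ Y] {ε : ℝ}
    (hε : 0 < ε) (hε1 : ε ≤ 1) :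
    ∃ g : Y ≃L[ℝ] Y, (∀ y, g y = ε • y) ∧ (∀ y, g.symm y = ε⁻¹ • y) ∧
      max 1 (max ‖(g.symm : Y →L[ℝ] Y)‖ ‖(g : Y →L[ℝ] Y)‖) ≤ ε⁻¹ ∧
      max 1 (max ‖(g.symm.symm : Y →L[ℝ] Y)‖ ‖(g.symm : Y →L[ℝ] Y)‖) ≤ ε⁻¹ := by
  have hε0 : ε ≠ 0 := hε.ne'
  have hinv : 1 ≤ ε⁻¹ := (one_le_inv₀ hε).2 hε1
  set g : Y ≃L[ℝ] Y := ContinuousLinearEquiv.equivOfInverse (ε • ContinuousLinearMap.id ℝ Y)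
    (ε⁻¹ • ContinuousLinearMap.id ℝ Y) (fun y => by simp [smul_smul, hε0])
    (fun y => by simp [smul_smul, hε0]) with hg
  have h1 : ‖(g : Y →L[ℝ] Y)‖ ≤ ε⁻¹ := by
    refine ContinuousLinearMap.opNorm_le_bound _ (by positivity) fun y => ?_
    rw [show (g : Y →L[ℝ] Y) y = ε • y from rfl, norm_smul, Real.norm_of_nonneg hε.le]
    exact mul_le_mul_of_nonneg_right (hε1.trans hinv) (norm_nonneg _)
  have h2 : ‖(g.symm : Y →L[ℝ] Y)‖ ≤ ε⁻¹ := by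
    refine ContinuousLinearMap.opNorm_le_bound _ (by positivity) fun y => ?_
    rw [show (g.symm : Y →L[ℝ] Y) y = ε⁻¹ • y from rfl, norm_smul, Real.norm_of_nonneg (inv_nonneg.2 hε.le)]
  refine ⟨g, fun y => rfl, fun y => rfl, max_le hinv (max_le h2 h1), ?_⟩
  rw [ContinuousLinearEquiv.symm_symm]
  exact max_le hinv (max_le h1 h2)

/-- **Z1-explicit E4 (single-scale lattice partition of unity for separated test functions, explicit degree
dependence).**  Let `T` be a continuous linear functional on `𝓢((ℝ⁴)ⁿ, ℂ)` whose localised versions obey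
HLoc: for slot cutoffs `θᵢ` with pairwise disjoint supports and `G = (∏ᵢ θᵢ(xᵢ)) F`,
`‖T G‖ ≤ M Kⁿ ∏ᵢ |θᵢ|_t |F|_{nt}`.  Then for `0 < ε ≤ 1` and every compactly supported `F` whose support
stays at pairwise slot distances `≥ 64 ε`,
`‖T F‖ ≤ M Kⁿ A^{n+1} (n+1)^{2n(t+3)} ε^{-16n(t+3)} |F|_{n(4t+12)}` with `A = A(t) ≥ 1` independent of `n`
(polynomial weights instead of windows: the decay sits in the slot cutoffs `θ'_b = bump_b · (1+‖z‖²)^{-(t+4)}`,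
whose Schwartz norms involve only the fixed order `t`, and the multiplier `∏ᵢ (1+‖xᵢ‖²)^{t+4}` on `F` is a
polynomial with explicit Leibniz bounds; rescaling makes the `ε`-dependence an explicit power). [folklore] -/
theorem separatedScaleBound_explicit : ∀ t : ℕ, ∃ A : ℝ, 1 ≤ A ∧ ∀ (n : ℕ) (T : 𝓢((Fin n → EuclideanSpace ℝ (Fin 4)), ℂ) →L[ℂ] ℂ) (M K : ℝ), 0 ≤ M → 0 ≤ K → (∀ (θ : Fin n → 𝓢(EuclideanSpace ℝ (Fin 4), ℂ)), (∀ i j, i ≠ j → Disjoint (tsupport (θ i : EuclideanSpace ℝ (Fin 4) → ℂ)) (tsupport (θ j : EuclideanSpace ℝ (Fin 4) → ℂ))) → ∀ (G F : 𝓢((Fin n → EuclideanSpace ℝ (Fin 4)), ℂ)), (∀ x, G x = (∏ i, θ i (x i)) * F x) → ‖T G‖ ≤ M * K ^ n * (∏ i, schwartzNorm t (θ i)) * schwartzNorm (n * t) F) → ∀ ε : ℝ, 0 < ε → ε ≤ 1 → ∀ F : 𝓢((Fin n → EuclideanSpace ℝ (Fin 4)), ℂ), HasCompactSupport (F : (Fin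 n → EuclideanSpace ℝ (Fin 4)) → ℂ) → (∀ x ∈ tsupport (F : (Fin n → EuclideanSpace ℝ (Fin 4)) → ℂ), ∀ i j, i ≠ j → 64 * ε ≤ ‖x i - x j‖) → ‖T F‖ ≤ M * K ^ n * A ^ (n + 1) * ((n : ℝ) + 1) ^ (2 * n * (t + 3)) * ε⁻¹ ^ (16 * n * (t + 3)) * schwartzNorm (n * (4 * t + 12)) F := by
  intro t
  obtain ⟨A₃, hA₃, hunit⟩ := unitScaleBound_explicit t
  refine ⟨A₃, hA₃, ?_⟩
  intro n T M K hM hK hloc ε hε hε1 F _ hsep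
  obtain ⟨D, hD, hDs, hDc, hDc'⟩ := exists_dilationEquiv (Fin n → EuclideanSpace ℝ (Fin 4)) hε hε1
  obtain ⟨d, -, hds, -, hdc'⟩ := exists_dilationEquiv (EuclideanSpace ℝ (Fin 4)) hε hε1
  -- the pulled-back functional `T_ε = T ∘ (· ∘ ε⁻¹)` obeys HLoc with `M ε^{-4nt} Kⁿ`
  set T₁ : 𝓢((Fin n → EuclideanSpace ℝ (Fin 4)), ℂ) →L[ℂ] ℂ :=
    T.comp (SchwartzMap.compCLMOfContinuousLinearEquiv ℂ D.symm) with hT₁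
  have hloc₁ : ∀ (θ : Fin n → 𝓢(EuclideanSpace ℝ (Fin 4), ℂ)),
      (∀ i j, i ≠ j → Disjoint (tsupport (θ i : EuclideanSpace ℝ (Fin 4) → ℂ))
        (tsupport (θ j : EuclideanSpace ℝ (Fin 4) → ℂ))) →
      ∀ (G F : 𝓢((Fin n → EuclideanSpace ℝ (Fin 4)), ℂ)), (∀ x, G x = (∏ i, θ i (x i)) * F x) →
        ‖T₁ G‖ ≤ M * ε⁻¹ ^ (4 * (n * t)) * K ^ n * (∏ i, schwartzNorm t (θ i)) *
          schwartzNorm (n * t) F := by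
    intro θ hθ G F' hG
    have hθ' : ∀ i j, i ≠ j → Disjoint
        (tsupport (SchwartzMap.compCLMOfContinuousLinearEquiv ℂ d.symm (θ i) : EuclideanSpace ℝ (Fin 4) → ℂ))
        (tsupport (SchwartzMap.compCLMOfContinuousLinearEquiv ℂ d.symm (θ j) : EuclideanSpace ℝ (Fin 4) → ℂ)) :=
      fun i j hij => ((hθ i j hij).preimage d.symm).mono
        (tsupport_comp_subset_preimage (θ i : EuclideanSpace ℝ (Fin 4) → ℂ) d.symm.continuous)
        (tsupport_comp_subset_preimage (θ j : EuclideanSpace ℝ (Fin 4) → ℂ) d.symm.continuous)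
    have hG' : ∀ x, SchwartzMap.compCLMOfContinuousLinearEquiv ℂ D.symm G x =
        (∏ i, SchwartzMap.compCLMOfContinuousLinearEquiv ℂ d.symm (θ i) (x i)) *
          SchwartzMap.compCLMOfContinuousLinearEquiv ℂ D.symm F' x := by
      intro x
      simp only [SchwartzMap.compCLMOfContinuousLinearEquiv_apply, Function.comp_apply, hG, hDs, hds,
        Pi.smul_apply]
    have h1 := hloc _ hθ' _ _ hG'
    have h3 : schwartzNorm (n * t) (SchwartzMap.compCLMOfContinuousLinearEquiv ℂ D.symm F') ≤
        ε⁻¹ ^ (2 * (n * t)) * schwartzNorm (n * t) F' :=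
      (NuclearExpansion.schwartzNorm_compCLMOfContinuousLinearEquiv_le (n * t) D.symm F').trans
        (mul_le_mul_of_nonneg_right (pow_le_pow_left₀ (by positivity) hDc' _) (schwartzNorm_nonneg _ _))
    have h4 : ∏ i, schwartzNorm t (SchwartzMap.compCLMOfContinuousLinearEquiv ℂ d.symm (θ i)) ≤
        (ε⁻¹ ^ (2 * t)) ^ n * ∏ i, schwartzNorm t (θ i) := by
      calc ∏ i, schwartzNorm t (SchwartzMap.compCLMOfContinuousLinearEquiv ℂ d.symm (θ i))
          ≤ ∏ i, ε⁻¹ ^ (2 * t) * schwartzNorm t (θ i) :=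
            Finset.prod_le_prod (fun i _ => schwartzNorm_nonneg _ _) fun i _ =>
              (NuclearExpansion.schwartzNorm_compCLMOfContinuousLinearEquiv_le t d.symm (θ i)).trans
                (mul_le_mul_of_nonneg_right (pow_le_pow_left₀ (by positivity) hdc' _)
                  (schwartzNorm_nonneg _ _))
        _ = (ε⁻¹ ^ (2 * t)) ^ n * ∏ i, schwartzNorm t (θ i) := by
            rw [Finset.prod_mul_distrib, Finset.prod_const, Finset.card_univ, Fintype.card_fin]
    have hπ0 : 0 ≤ ∏ i, schwartzNorm t (θ i) := Finset.prod_nonneg fun i _ => schwartzNorm_nonneg _ _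
    show ‖T (SchwartzMap.compCLMOfContinuousLinearEquiv ℂ D.symm G)‖ ≤ _
    calc ‖T (SchwartzMap.compCLMOfContinuousLinearEquiv ℂ D.symm G)‖
        ≤ M * K ^ n * (∏ i, schwartzNorm t (SchwartzMap.compCLMOfContinuousLinearEquiv ℂ d.symm (θ i))) *
            schwartzNorm (n * t) (SchwartzMap.compCLMOfContinuousLinearEquiv ℂ D.symm F') := h1
      _ ≤ M * K ^ n * ((ε⁻¹ ^ (2 * t)) ^ n * ∏ i, schwartzNorm t (θ i)) *
            (ε⁻¹ ^ (2 * (n * t)) * schwartzNorm (n * t) F') :=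
          mul_le_mul (mul_le_mul_of_nonneg_left h4 (by positivity)) h3 (schwartzNorm_nonneg _ _)
            (by positivity)
      _ = M * ε⁻¹ ^ (4 * (n * t)) * K ^ n * (∏ i, schwartzNorm t (θ i)) * schwartzNorm (n * t) F' := by
          ring
  -- the rescaled test function `F_ε = F(ε ·)` is `64`-separated
  set F₁ := SchwartzMap.compCLMOfContinuousLinearEquiv ℂ D F with hF₁
  have hsep₁ : ∀ x ∈ tsupport (F₁ : (Fin n → EuclideanSpace ℝ (Fin 4)) → ℂ), ∀ i j, i ≠ j →
      (64 : ℝ) ≤ ‖x i - x j‖ := by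
    intro x hx i j hij
    have hx' : D x ∈ tsupport (F : (Fin n → EuclideanSpace ℝ (Fin 4)) → ℂ) :=
      tsupport_comp_subset_preimage (F : (Fin n → EuclideanSpace ℝ (Fin 4)) → ℂ) D.continuous hx
    have h := hsep (D x) hx' i j hij
    rw [hD, Pi.smul_apply, Pi.smul_apply, ← smul_sub, norm_smul, Real.norm_of_nonneg hε.le] at h
    nlinarith
  have hA : 0 ≤ M * ε⁻¹ ^ (4 * (n * t)) * K ^ n := by positivity
  have hmain := hunit n T₁ (M * ε⁻¹ ^ (4 * (n * t)) * K ^ n) hA hloc₁ F₁ hsep₁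
  have hTF : T F = T₁ F₁ := by
    show T F = T (SchwartzMap.compCLMOfContinuousLinearEquiv ℂ D.symm F₁)
    congr 1
    ext x
    simp only [hF₁, SchwartzMap.compCLMOfContinuousLinearEquiv_apply, Function.comp_apply,
      ContinuousLinearEquiv.apply_symm_apply]
  have hF₁n : schwartzNorm (n * (3 * t + 8)) F₁ ≤ ε⁻¹ ^ (2 * (n * (3 * t + 8))) * schwartzNorm (n * (3 * t + 8)) F :=
    (NuclearExpansion.schwartzNorm_compCLMOfContinuousLinearEquiv_le _ D F).trans
      (mul_le_mul_of_nonneg_right (pow_le_pow_left₀ (by positivity) hDc _) (schwartzNorm_nonneg _ _))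
  -- enlarge to the registered shape
  have hinv : 1 ≤ ε⁻¹ := (one_le_inv₀ hε).2 hε1
  have hn1 : (1 : ℝ) ≤ (n : ℝ) + 1 := le_add_of_nonneg_left n.cast_nonneg
  have hεpow : ε⁻¹ ^ (4 * (n * t)) * ε⁻¹ ^ (2 * (n * (3 * t + 8))) ≤ ε⁻¹ ^ (16 * n * (t + 3)) := by
    rw [← pow_add]
    exact pow_le_pow_right₀ hinv (by nlinarith [Nat.zero_le (n * t), Nat.zero_le n])
  have hApow : A₃ ^ n ≤ A₃ ^ (n + 1) := pow_le_pow_right₀ hA₃ (Nat.le_succ n)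
  have hnpow : ((n : ℝ) + 1) ^ (n * t) ≤ ((n : ℝ) + 1) ^ (2 * n * (t + 3)) :=
    pow_le_pow_right₀ hn1 (by nlinarith [Nat.zero_le (n * t), Nat.zero_le n])
  have hFmono : schwartzNorm (n * (3 * t + 8)) F ≤ schwartzNorm (n * (4 * t + 12)) F :=
    schwartzNorm_mono (Nat.mul_le_mul_left n (by omega)) F
  have hF0 : 0 ≤ schwartzNorm (n * (3 * t + 8)) F := schwartzNorm_nonneg _ _
  have hA₃0 : 0 ≤ A₃ := zero_le_one.trans hA₃
  rw [hTF]
  calc ‖T₁ F₁‖ ≤ M * ε⁻¹ ^ (4 * (n * t)) * K ^ n * A₃ ^ n * ((n : ℝ) + 1) ^ (n * t) *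
        schwartzNorm (n * (3 * t + 8)) F₁ := hmain
    _ ≤ M * ε⁻¹ ^ (4 * (n * t)) * K ^ n * A₃ ^ n * ((n : ℝ) + 1) ^ (n * t) *
        (ε⁻¹ ^ (2 * (n * (3 * t + 8))) * schwartzNorm (n * (3 * t + 8)) F) :=
        mul_le_mul_of_nonneg_left hF₁n (by positivity)
    _ = M * K ^ n * (A₃ ^ n * ((n : ℝ) + 1) ^ (n * t) * (ε⁻¹ ^ (4 * (n * t)) * ε⁻¹ ^ (2 * (n * (3 * t + 8)))) *
        schwartzNorm (n * (3 * t + 8)) F) := by ring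
    _ ≤ M * K ^ n * (A₃ ^ (n + 1) * ((n : ℝ) + 1) ^ (2 * n * (t + 3)) * ε⁻¹ ^ (16 * n * (t + 3)) *
        schwartzNorm (n * (4 * t + 12)) F) :=
        mul_le_mul_of_nonneg_left (mul_le_mul (mul_le_mul (mul_le_mul hApow hnpow (by positivity)
          (by positivity)) hεpow (by positivity) (by positivity)) hFmono hF0 (by positivity)) (by positivity)
    _ = M * K ^ n * A₃ ^ (n + 1) * ((n : ℝ) + 1) ^ (2 * n * (t + 3)) * ε⁻¹ ^ (16 * n * (t + 3)) *
        schwartzNorm (n * (4 * t + 12)) F := by ring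

end Summit.QuantumFields.YangMills.Cruxes.HypercubicLimit.CouplingResponse

end
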